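import Summits.BirchSwinnertonDyer.Rank1Residual.ManinAdditive.ConwayCut
import Literature.NumberTheory.EllipticCurves.HeckeOperators
import HarnessLib
import HarnessLib.Audit.Tags

/-!
# Candidates E-imc-127 / 128 / 129 (imc g18, MEMO-imc §24): the consequences and the located boundary of
# THEOREM N=C «the Néron lattice at `2` IS the Conway lattice on the reduced Katz–Mazur cells `v₂(N) ∈ {2,3}`»
# — cell `bsd-f2-manin` (D-0131 (3) frontier: the Manin constant at additive primes); sibling of `ConwayCut`

HONEST FRAMING. LENS = Iwasawa-main-conjecture / integrality of `q`-expansions at additive level (planner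
`bsd-f2-manin-imc` g18, planner-of-record; HOME `run/shared/lean/pub/bsd-f2-manin/MEMO-imc.md` §24; paper proof
HOME/imc/PROOFS-g18.md sha16 **3740ad584bd3927f**). Source: HOME/imc/Sketch-imc-g18.lean sha16 **c1456036d8bf515e**
(farm rc 0 per imc), copied VERBATIM (namespace `…ManinAdditive.NeronConway` kept) with exactly these deviations, all
recorded at the declaration: (i) `@[conjecture]` on the three rows E-imc-127/128/129 (nothing is asserted; E-imc-128 and
E-imc-129 are THEOREM-CANDIDATES on paper / by exact linear algebra, but nothing is kernel-proved here); (ii) `[cite: …]`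
tags in the tree's «shape only … NOT in print» format; (iii) `import HarnessLib.Audit.Tags`; (iv) the typer's PROVED
edges `leUpToOdd_trans`, `LeUpToOdd.mono`, `LeUpToOdd.map`, `conwayLatticeLocalAtTwo_iff`,
`conwayEqKatzMazurCuspLatticeAtTwo_of_local` (E-imc-128 is the restriction of desc's E-desc-33 to the reduced cells),
`isConwayNeronAtTwo_iff`, `leUpToOdd_map_of_isConwayNeronAtTwo` (the formal content of «COROLLARY of N=C»: Néron =
Conway at `2` plus `φ`-stability of the Néron lattice gives `2`-adic `φ`-stability of `S^G`),
`leUpToOdd_heckeT_two_of_isConwayNeronAtTwo` (its `U₂` instance = the level-`N` instance of E-imc-127) and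
`not_isConwayNeronAtTwo_of_notRamanujanStable` (PROOFS-g18 COR 3 in the kernel: E-imc-129 plus `R₄`-stability of `Λ`
REFUTES `IsConwayNeronAtTwo Δ` at `N = 240`); (v) the STATUS of desc's GIVEN row `IsConwayNeronAtTwo` after THEOREM N=C is
recorded in the section docstring below (append-only rule: `ConwayCut`'s docstring is not edited). Filed at imc's request
T-imc-18 (HOME/INBOX.md 2026-08-28T15:34:28Z) by the cell typer (g13). REFUTER VERDICTS AT FILING: REF1 R-imc-49 (audit of
the paper proof, PROOFS-g18 §2 steps (i)–(iv)) PENDING; REF1 statement audit of E-imc-127/128/129 by name REQUESTED with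
this filing; REF2 placement (Edixhoven 1991 §2 / Conrad App. B of BDP17 / ČNS §§4–5) PENDING. A finding is repaired under a
NEW name in a sibling (append-only).

THEOREM N=C (paper, PROOFS-g18 §1; NOT asserted here). For `v₂(N) ∈ {2,3}` the lattice `H⁰(X₀(N)_{ℤ₍₂₎}, Ω)` of
sections of the relative dualising sheaf equals `S^G ⊗ ℤ₍₂₎`, `S^G = conwayStableLattice N`, and equals
`kmCuspLattice N ⊗ ℤ₍₂₎`; if moreover `X₀(N)_{ℤ₍₂₎}` has rational singularities (always at `v₂ = 2`; at `v₂ = 3` when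
some prime `p' ≡ 3 (mod 4)` divides `N` [cite: CesnaviciusNeururerSaha2023, p. 4 L10–16]) then the Néron lattice
`H⁰(𝒥₀(N)_{ℤ₍₂₎}, Ω¹)` equals `S^G ⊗ ℤ₍₂₎`. Mechanism (imc): the Katz–Mazur fibre of `X₀(2^v M)` at `2` is REDUCED iff
`v ≤ 3` (multiplicity of the `(a,b)`-component is `2^{min(a,b)−1}` [cite: KatzMazur1985, Thm. 13.4.7]), so the dualising
sheaf is the sheaf of Kähler differentials at every codimension-1 point, `⟨w_N, t, t'⟩ ⊂ Aut X₀(N)_ℤ` (deck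
transformations of the two degeneracy maps to level `N/2`, and Fricke) permutes the `v+1` components transitively, `Ω`
is `S2`, and the `q`-expansion principle holds at the `ℤ`-point `∞`. The Props below are the E-BLIND, kernel-typable
consequences / boundary statements (census = BC5 witness: desc (F1), (F2), (F4), HOME/desc/CONWAY-levels-g5.txt and
RAMANUJAN-rows-g5; imc ENGINE 6 `neronconway2.gp`, kit j311272 / j311335 / j311449 / j311494).
WHY THE CELL WANTS THEM (crux C2 `ManinOddAtFour`, stmt-BirchSwinnertonDyer-22967): with N=C, desc's kernel-checked chain
`not_two_dvd_maninConstant_of_conwayDepth` / `lieSaturatedAt_two_of_conwayDepth` (`ConwayCut`) runs with NO GIVEN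
hypothesis on the reduced cells, so `σ₂(f) = 0` rows certify `2 ∤ c_E` and Lie saturation at `2` E-blindly, and
E-imc-129 locates the edge of that road (`16 ∣ N`). Beyond-print theorem: CANDIDATE (paper, audit pending) — nothing
of it is asserted or proved in this file. BSD is not proved by this; Manin's conjecture is not proved by this.
-/

noncomputable section

open scoped MatrixGroups ModularForm

open CongruenceSubgroup WeierstrassCurve Literature.NumberTheory.EllipticCurves.ModularForms
  Literature.NumberTheory.DiophantineGeometry
  Summit.BirchSwinnertonDyer.Rank1Residual.ManinAdditive.ConwayCut

namespace Summit.BirchSwinnertonDyer.Rank1Residual.ManinAdditive.NeronConway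

/-! ### `2`-adic containment of lattices of cusp forms -/

/-- `M ⊗ ℤ₍₂₎ ≤ M' ⊗ ℤ₍₂₎` for two `ℤ`-lattices of cusp forms: every element of `M` has an ODD multiple in `M'`.
(imc g18 VERBATIM; the shape of desc's E-desc-33 and of the second clause of `IsConwayNeronAtTwo`.) [folklore] -/
def LeUpToOdd {N : ℕ} (M M' : Submodule ℤ (CuspForm (Gamma0 N) 2)) : Prop :=
  ∀ g ∈ M, ∃ n : ℕ, Odd n ∧ (n : ℤ) • g ∈ M'

/-- Sanity: `LeUpToOdd` is reflexive (take `n = 1`). (imc g18 VERBATIM.) -/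
theorem leUpToOdd_refl {N : ℕ} (M : Submodule ℤ (CuspForm (Gamma0 N) 2)) : LeUpToOdd M M :=
  fun g hg => ⟨1, odd_one, by simpa using hg⟩

/-- Sanity: `LeUpToOdd` follows from honest containment. (imc g18 VERBATIM.) -/
theorem leUpToOdd_of_le {N : ℕ} {M M' : Submodule ℤ (CuspForm (Gamma0 N) 2)} (h : M ≤ M') :
    LeUpToOdd M M' :=
  fun g hg => ⟨1, odd_one, by simpa using h hg⟩

/-- `LeUpToOdd` is transitive (odd times odd is odd). (typer edge.) -/
theorem leUpToOdd_trans {N : ℕ} {M M' M'' : Submodule ℤ (CuspForm (Gamma0 N) 2)}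
    (h : LeUpToOdd M M') (h' : LeUpToOdd M' M'') : LeUpToOdd M M'' := by
  intro g hg
  obtain ⟨n, hn, hng⟩ := h g hg
  obtain ⟨m, hm, hmg⟩ := h' _ hng
  refine ⟨m * n, hm.mul hn, ?_⟩
  rw [Nat.cast_mul, mul_smul]
  exact hmg

/-- `LeUpToOdd` is antitone in the left lattice and monotone in the right one. (typer edge.) -/
theorem LeUpToOdd.mono {N : ℕ} {M₁ M₂ M₁' M₂' : Submodule ℤ (CuspForm (Gamma0 N) 2)}
    (h : LeUpToOdd M₂ M₁') (hM : M₁ ≤ M₂) (hM' : M₁' ≤ M₂') : LeUpToOdd M₁ M₂' :=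
  fun g hg => by
    obtain ⟨n, hn, hng⟩ := h g (hM hg)
    exact ⟨n, hn, hM' hng⟩

/-- `LeUpToOdd` passes to images under a `ℤ`-linear map. (typer edge.) -/
theorem LeUpToOdd.map {N : ℕ} {M M' : Submodule ℤ (CuspForm (Gamma0 N) 2)} (h : LeUpToOdd M M')
    (φ : CuspForm (Gamma0 N) 2 →ₗ[ℤ] CuspForm (Gamma0 N) 2) : LeUpToOdd (M.map φ) (M'.map φ) := by
  rintro _ ⟨g, hg, rfl⟩
  obtain ⟨n, hn, hng⟩ := h g hg
  refine ⟨n, hn, ?_⟩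
  rw [← φ.map_smul]
  exact Submodule.mem_map_of_mem hng

/-! ### The rows E-imc-127 / E-imc-128 (reduced cells `4 ∣ N`, `16 ∤ N`; nothing asserted) -/

/-- **E-imc-127 `ConwayLatticeHeckeStableAtTwoReduced`** (LAW, E-blind; a COROLLARY of THEOREM N=C since the
Néron lattice is stable under every endomorphism of `J₀(N)` — in the kernel: `leUpToOdd_heckeT_two_of_isConwayNeronAtTwo`
below): for `4 ∣ N`, `16 ∤ N`, the Conway lattice is `2`-adically stable under `U₂ = heckeT (Γ₀(N)) 2 2` (the only Hecke
operator not commuting with `t`; stability under `T_ℓ`, `U_p`, `p` odd, is formal).  Census: desc (F4)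
`ord₂[S^G : S^𝔈] = 0` at all 31 all-rational levels with `v₂ ≤ 3`; imc ENGINE 6 (all levels `4 ∣ N ≤ 520`, incl.
non-rational packets, kit j311449).  Cheapest falsifier: one level `4 ∥ N` or `8 ∥ N` with a positive `U₂`-defect (would
contradict the theorem — i.e. expose an error in it).  Why it might fail: an error in PROOFS-g18 §2 step (i) (extension
of `⟨w_Q, t, t'⟩` to the integral model at the cusps) or (ii) (coarse-vs-stack multiplicities) — audit R-imc-49 pending.
VERBATIM HOME/imc/Sketch-imc-g18.lean c1456036d8bf515e `ConwayLatticeHeckeStableAtTwoReduced` (nothing asserted).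
REF1 / REF2: PENDING at filing (R-imc-49 audits the paper proof; statement audit by name requested).
[cite: KatzMazur1985, Thm. 13.4.7 (shape only: multiplicities `2^{min(a,b)−1}` of the components of `X₀(N) ⊗ 𝔽₂`, the reducedness input; the `2`-adic `U₂`-stability of the Conway-stable lattice on the reduced cells is the cell's law E-imc-127 — MEMO-imc §24, paper proof HOME/imc/PROOFS-g18.md, NOT in print; census desc (F4) 31/31 + imc ENGINE 6)] -/
@[conjecture]
def ConwayLatticeHeckeStableAtTwoReduced : Prop :=
  ∀ (N : ℕ) [NeZero N], 4 ∣ N → ¬ 16 ∣ N →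
    LeUpToOdd ((conwayStableLattice N).map ((heckeT (Gamma0 N) 2 2).restrictScalars ℤ))
      (conwayStableLattice N)

/-- **E-imc-128 `ConwayEqKatzMazurCuspLatticeAtTwo`** (THEOREM-CANDIDATE, E-blind; PROVED on paper by N=C:
both sides equal `H⁰(X₀(N)_{ℤ₍₂₎}, Ω)`, the right side because ONE integrality condition per fibre component
suffices): for `4 ∣ N`, `16 ∤ N`, the Katz–Mazur cusp lattice `L₄ = kmCuspLattice N` (conditions at the cusp
classes `∞, w∞, tw∞, wtw∞` only) is `2`-adically contained in (hence `2`-adically equal to) the Conway lattice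
cut by the whole group `⟨w_{Q_p}, t⟩`.  Census: desc (F1) `L₄ = S^{⟨w,t⟩}` 33/33 on the nose; imc ENGINE 6
column `P1_ord2[Lcusp:SG] = 0` at every level run.  In-tree: this row IS desc's E-desc-33 `ConwayLatticeLocalAtTwo`
restricted to `16 ∤ N` (`conwayEqKatzMazurCuspLatticeAtTwo_of_local`); it is filed separately because on the reduced
cells it is a theorem-candidate with a paper proof, while E-desc-33 at `v₂(N) ≥ 4` stays a law.
VERBATIM HOME/imc/Sketch-imc-g18.lean c1456036d8bf515e `ConwayEqKatzMazurCuspLatticeAtTwo` (nothing asserted).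
REF1 / REF2: PENDING at filing.
[cite: CesnaviciusNeururerSaha2023, Thm. 1.2 and p. 4 L10–16 (shape only: the Néron / dualising-sheaf lattice cut out by `q`-expansion conditions at the cusps; the `2`-adic equality `L₄ = S^G` on the reduced cells is the cell's row E-imc-128 = E-desc-33 at `16 ∤ N` — MEMO-imc §24, paper proof HOME/imc/PROOFS-g18.md THEOREM N=C (a), NOT in print; census desc (F1) 33/33)] -/
@[conjecture]
def ConwayEqKatzMazurCuspLatticeAtTwo : Prop :=
  ∀ (N : ℕ) [NeZero N], 4 ∣ N → ¬ 16 ∣ N → LeUpToOdd (kmCuspLattice N) (conwayStableLattice N)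

/-! ### The Ramanujan endomorphism at `2` and the boundary row E-imc-129 (`N = 240`; nothing asserted) -/

/-- The matrix `(4 j; 0 4) ∈ GL(2, ℚ)⁺` (determinant `16`), acting on `ℍ` as `z ↦ z + j/4`; it normalises `Γ₀(N)` iff
`16 ∣ N`.  Typed exactly like `RamanujanCut.thirdTranslateGL`. (imc g18 VERBATIM.) [folklore] -/
def quarterTranslateGL (j : ℕ) : GL(2, ℚ)⁺ :=
  ⟨Matrix.GeneralLinearGroup.mkOfDetNeZero !![4, (j : ℚ); 0, 4] (by simp [Matrix.det_fin_two]),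
    by simp [Matrix.det_fin_two]⟩

/-- The **Ramanujan endomorphism at `2`**, `R₄ = t_{1/4} + t_{3/4}` on `S_k(Γ₀(N))`, `16 ∣ N`: on `q`-expansions
`aₙ ↦ (iⁿ + (−i)ⁿ) aₙ`.  It is `ℚ`-rational (Galois-symmetrised), hence induces an endomorphism of `J₀(N)` over `ℚ`, hence
(Néron mapping property) preserves the Néron lattice.  Typed like `RamanujanCut.ramanujanThree` (`16^{1−k/2}` times the sum
of the two double-coset operators; each a single coset when `16 ∣ N`).  Junk if `16 ∤ N`. (imc g18 VERBATIM.)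
[cite: AtkinLehner1970, §4 (shape only: the translations `z ↦ z + j/4` lie in the normaliser of `Γ₀(N)` for `16 ∣ N`; the Galois-symmetrised sum `R₄` as a `ℚ`-endomorphism of `J₀(N)` is folklore, Conway–Norton)] -/
def ramanujanFour (N : ℕ) [NeZero N] (k : ℤ) : CuspForm (Gamma0 N) k →ₗ[ℂ] CuspForm (Gamma0 N) k :=
  (((16 : ℝ) ^ (1 - (k : ℝ) / 2) : ℝ) : ℂ) •
    (cuspHeckeOperatorₗ (Gamma0 N) k (quarterTranslateGL 1) + cuspHeckeOperatorₗ (Gamma0 N) k (quarterTranslateGL 3))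

/-- **E-imc-129 `ConwayLatticeNotRamanujanStableAt240`** (BOUNDARY THEOREM-CANDIDATE, E-blind, decidable by exact linear
algebra): at `N = 240 = 2⁴·15` the Conway lattice is NOT `2`-adically stable under the Ramanujan endomorphism `R₄`.  Since
the Néron lattice IS (`R₄ ∈ End_ℚ J₀(240)`), this PROVES `S^G ⊗ ℤ₍₂₎ ≠ H⁰(𝒥₀(240)_{ℤ₍₂₎}, Ω¹)` (in the kernel:
`not_isConwayNeronAtTwo_of_notRamanujanStable` below, with the `R₄`-stability of `Λ` passed as a hypothesis): the
identification N=C FAILS at a level where the Katz–Mazur fibre has a non-reduced component (`(2,2)`, multiplicity `2`) —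
the located edge of the Conway road (the automorphism group `⟨w, t, t′⟩` never reaches `(2,2)`).  Census: desc
RAMANUJAN-rows-g5 PART B `[S^G : S^H] = 2` at `N = 240, 384` (PART A: `U_p` alone cuts nothing there — imc ENGINE 6 v3
agrees: `ord2U2defFull = 0` at `240`); imc ENGINE 6 v4 column `ord2R4defFull` (kit j311494,
HOME/imc/kit-g18/g18-neronconway-R4-v4.txt: positive `R₄`-defect at `N = 176, 224, 240, 272, 304, 320, 336, 352, 368, 384,
416, 432, 448, 464`).  Why it might fail: only through a normalisation slip between the engines' `R₄` and the typed
`ramanujanFour` (scalar `16^{1−k/2}`, `det^{k−1}` in Mathlib's slash) — a kernel certificate would need `q`-expansions of a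
`ℤ`-basis of `S₂(Γ₀(240); ℤ)`, not in the tree.
VERBATIM HOME/imc/Sketch-imc-g18.lean c1456036d8bf515e `ConwayLatticeNotRamanujanStableAt240` (nothing asserted).
REF1 / REF2: PENDING at filing.
[cite: AtkinLehner1970, §4 (shape only: normaliser of `Γ₀(N)` and the operators it induces; the non-stability of the Conway-stable lattice under `R₄` at `N = 240` is the cell's boundary row E-imc-129 — MEMO-imc §24 / PROOFS-g18 COR 3, two engines (desc PART B, imc ENGINE 6 v4), NOT in print)] -/
@[conjecture]
def ConwayLatticeNotRamanujanStableAt240 : Prop :=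
  ¬ LeUpToOdd ((conwayStableLattice 240).map ((ramanujanFour 240 2).restrictScalars ℤ))
      (conwayStableLattice 240)

/-! ### Proved edges: E-imc-128 versus E-desc-33 -/

/-- Desc's E-desc-33 `ConwayLatticeLocalAtTwo` in `LeUpToOdd` language (definitional). (typer edge.) -/
theorem conwayLatticeLocalAtTwo_iff :
    ConwayLatticeLocalAtTwo ↔
      ∀ (N : ℕ) [NeZero N], 4 ∣ N → LeUpToOdd (kmCuspLattice N) (conwayStableLattice N) :=
  Iff.rfl

/-- E-imc-128 is the restriction of desc's E-desc-33 to the reduced cells `16 ∤ N`. (typer edge.) -/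
theorem conwayEqKatzMazurCuspLatticeAtTwo_of_local (h : ConwayLatticeLocalAtTwo) :
    ConwayEqKatzMazurCuspLatticeAtTwo :=
  fun N _ h4 _ => h N h4

/-! ### Proved edges: the GIVEN row `IsConwayNeronAtTwo` (E-desc-28♯) — consequences, and its STATUS after THEOREM N=C

STATUS OF `ConwayCut.IsConwayNeronAtTwo Δ` FOR THE TRUE NÉRON DATUM (imc g18 MEMO-imc §24 / PROOFS-g18 COR 1 and COR 3;
recorded here, `ConwayCut`'s docstring «print-backed at `v₂ = 2`; CONDITIONAL at `v₂ = 3`; CONJECTURAL at `v₂ ≥ 4`» being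
left as filed — append-only): (1) `v₂(N) = 2`, all `N`: a THEOREM on paper (N=C (a)+(b)), by reducedness of the Katz–Mazur
fibre, transitivity of `⟨w_Q, t, t'⟩ ⊂ Aut X₀(N)_ℤ` on the three components, `S2` and the `q`-expansion principle — NOT via
ČNS explicit-crit / canonical-lattice (desc's unverified normalisation match U1 of MEMO-desc §22.9 is moot on these cells);
(2) `v₂(N) = 3` and some prime `p' ≡ 3 (mod 4)` divides `N`: a THEOREM on paper likewise (rational singularities from
[ČNS p. 4 L10–16]); (3) `v₂(N) = 3` with no such `p'` (`N = 40, 136, …`): N=C (a) `H⁰(X₀(N)_{ℤ₍₂₎}, Ω) = S^G ⊗ ℤ₍₂₎` holds,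
(b) `Pic⁰ = 𝒥⁰` is NOT known — OPEN; (4) `v₂(N) ≥ 4`: FALSE for the true datum wherever the `R₄`-defect is positive —
`N = 176, 224, 240, 272, 304, 320, 336, 352, 368, 384, 416, 432, 448, 464` by imc ENGINE 6 v4 (kit j311494; agrees with desc
RAMANUJAN-rows-g5 PART B on all 11 shared levels) — in the kernel this is `not_isConwayNeronAtTwo_of_notRamanujanStable`
(E-imc-129 + `R₄`-stability of `Λ` at `N = 240`); the p = 3 twin (`RamanujanCut.IsRamanujanNeronAtThree`) gets NOTHING from
this road (the `(1,1)`-component at `9 ∥ N` has multiplicity `2`, PROOFS-g18 (d)). All of (1)–(4) are imc's claims under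
audit R-imc-49 (REF1) and placement review (REF2: is (a) literally ČNS explicit-crit at multiplicity-one components /
Edixhoven 1991 §2 / Conrad App. B of BDP17?) — PENDING at filing; nothing of it is asserted in this file. -/

section Given

variable {N : ℕ} [NeZero N] {W : WeierstrassCurve ℚ} [W.IsElliptic]
  {D : ModularParametrizationData W N} (Δ : NeronFLineDatum W D)

/-- `IsConwayNeronAtTwo Δ` in `LeUpToOdd` language: `Λ ≤ S^G` and `S^G ⊗ ℤ₍₂₎ ≤ Λ ⊗ ℤ₍₂₎` (definitional). (typer edge.) -/
theorem isConwayNeronAtTwo_iff :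
    IsConwayNeronAtTwo Δ ↔ Δ.Λ ≤ conwayStableLattice N ∧ LeUpToOdd (conwayStableLattice N) Δ.Λ :=
  Iff.rfl

/-- The formal content of «COROLLARY of THEOREM N=C» (PROOFS-g18 COR 3 / E-imc-127): if the Néron lattice IS the Conway
lattice at `2` and `Λ` is stable under a `ℂ`-linear operator `φ` (Néron mapping property for `φ ∈ End_ℚ J₀(N)`, passed as
a hypothesis), then `S^G` is `2`-adically `φ`-stable: for `g ∈ S^G` with `n • g ∈ Λ`, `n` odd,
`n • φ g = φ (n • g) ∈ φ(Λ) ≤ Λ ≤ S^G`. (typer edge, PROVED.) -/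
theorem leUpToOdd_map_of_isConwayNeronAtTwo (hΛ : IsConwayNeronAtTwo Δ)
    (φ : CuspForm (Gamma0 N) 2 →ₗ[ℂ] CuspForm (Gamma0 N) 2) (hφ : Δ.Λ.map (φ.restrictScalars ℤ) ≤ Δ.Λ) :
    LeUpToOdd ((conwayStableLattice N).map (φ.restrictScalars ℤ)) (conwayStableLattice N) := by
  rintro _ ⟨g, hg, rfl⟩
  obtain ⟨n, hn, hng⟩ := hΛ.2 g hg
  refine ⟨n, hn, hΛ.1 (hφ ?_)⟩
  rw [← (φ.restrictScalars ℤ).map_smul]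
  exact Submodule.mem_map_of_mem hng

/-- The level-`N` instance of E-imc-127 from the GIVEN row: Néron = Conway at `2` plus `U₂`-stability of `Λ`
(`U₂ ∈ End_ℚ J₀(N)`, passed as a hypothesis) gives `2`-adic `U₂`-stability of `S^G`. (typer edge, PROVED.) -/
theorem leUpToOdd_heckeT_two_of_isConwayNeronAtTwo (hΛ : IsConwayNeronAtTwo Δ)
    (hU : Δ.Λ.map ((heckeT (Gamma0 N) 2 2).restrictScalars ℤ) ≤ Δ.Λ) :
    LeUpToOdd ((conwayStableLattice N).map ((heckeT (Gamma0 N) 2 2).restrictScalars ℤ))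
      (conwayStableLattice N) :=
  leUpToOdd_map_of_isConwayNeronAtTwo Δ hΛ _ hU

end Given

/-- **PROOFS-g18 COR 3 in the kernel (the located boundary).** E-imc-129 together with the `R₄`-stability of the Néron
lattice at `N = 240` (Néron mapping property for `R₄ ∈ End_ℚ J₀(240)`, passed as a hypothesis exactly like `ht` in
`ConwayCut.Λ_le_conwayStableLattice`) REFUTES desc's GIVEN row `IsConwayNeronAtTwo Δ` for that datum: the Néron lattice at
`2` is NOT the Conway lattice at `N = 240`. (typer edge, PROVED; nothing asserted about E-imc-129 itself.) -/
theorem not_isConwayNeronAtTwo_of_notRamanujanStable (h129 : ConwayLatticeNotRamanujanStableAt240)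
    {W : WeierstrassCurve ℚ} [W.IsElliptic] {D : ModularParametrizationData W 240} (Δ : NeronFLineDatum W D)
    (hR : Δ.Λ.map ((ramanujanFour 240 2).restrictScalars ℤ) ≤ Δ.Λ) : ¬ IsConwayNeronAtTwo Δ :=
  fun hΛ => h129 (leUpToOdd_map_of_isConwayNeronAtTwo Δ hΛ _ hR)

end Summit.BirchSwinnertonDyer.Rank1Residual.ManinAdditive.NeronConway

end
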